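import Mathlib
import Summits.Ventures.PercRepro2.CoinChainReduction

/-!
# The GENERAL AND-switch chain as a coin system — the reduction to the chain functional
(blind cell PercRepro2, night-2 g19; proofs/NIGHT2-DARC.md §59.17)

The general chain of §56.1: `a'` entered from `ent' ⊆ U` by SURE coins, `a` entered from
`ent ⊆ U` by SURE coins AND from `a'` by one random coin `c a'` (`h`, entry set
`insert a' ent`).  After the two level reductions the `R`-law and gate on `U` are exactly
`ν · chainMix ent ent' ρ chainC chainD` and `ν · chainMix ent ent' ρ chainC chainD'`
(`rValK_sure_chainGen_eq`, `gValK_sure_chainGen_eq`: the three regions «meets `ent`»,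
«meets `ent'` only», «neither» carry the values `d`, `(1 − ρ)c + ρd`, `c`), so row 2′DARC at
the general chain follows from the chain functional (`chain_darc_of_functional`) — the
reduction `pureChain_darc_of_functional` with `ent = ∅`.
-/

namespace Summit.Ventures.PercRepro2.Coin

section ChainReductionGen

variable {V : Type*} {E : Type*} [Fintype V] [DecidableEq V] [Fintype E] [DecidableEq E]
  {R : Type*} [Field R] [LinearOrder R] [IsStrictOrderedRing R]
  {arcs : E → Finset (V × V)} {s : V} {U : Finset V} {ent ent' : Finset V} {c' : V → E}
  {a' a w : V} {c : V → E}

omit [Fintype V] [Fintype E] [DecidableEq E] [LinearOrder R] [IsStrictOrderedRing R] in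
/-- `tailWtK` for the entry set `insert a' ent` with sure coins on `ent`:
`(1 − ρ·[a' ∈ X]) · [X misses ent]`. -/
lemma tailWtK_insert_sure (pr : E → R) (c : V → E) (ha' : a' ∉ ent)
    (hsure : ∀ r ∈ ent, pr (c r) = 1) (X : Finset V) :
    tailWtK pr (insert a' ent) c X =
      (1 - pr (c a') * (if a' ∈ X then 1 else 0)) * (if ∃ r ∈ ent, r ∈ X then 0 else 1) := by
  unfold tailWtK
  rw [Finset.prod_insert ha']
  congr 1
  have := tailWtK_sure pr c hsure X
  unfold tailWtK at this
  exact this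

omit [Fintype V] [Fintype E] [DecidableEq E] [LinearOrder R] [IsStrictOrderedRing R] in
/-- With sure coins on `ent` and `ent'`, the nested `R`-value of the general chain is
`chainMix ent ent' ρ chainC chainD`. -/
lemma rValK_sure_chainGen_eq (A : Finset V → R) (pr : E → R) (ha' : a' ∉ ent)
    (hsure : ∀ r ∈ ent, pr (c r) = 1) (hsure' : ∀ r ∈ ent', pr (c' r) = 1)
    (W : Finset V) (ha'W : a' ∉ W) :
    tailWtK pr ent' c' W * rValK A pr (insert a' ent) c a W +
      (1 - tailWtK pr ent' c' W) * rValK A pr (insert a' ent) c a (W ∪ {a'}) =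
      chainMix ent ent' (pr (c a')) (fun X => A (chainPhi ent' a' X))
        (fun X => A (chainPhi ent' a' X ∪ {a})) W := by
  unfold rValK chainMix chainTheta chainPhi
  rw [tailWtK_sure pr c' hsure' W, tailWtK_insert_sure pr c ha' hsure,
    tailWtK_insert_sure pr c ha' hsure]
  have hu : (∃ r ∈ ent, r ∈ W ∨ r = a') ↔ ∃ r ∈ ent, r ∈ W := by
    constructor
    · rintro ⟨r, hr, h | h⟩
      · exact ⟨r, hr, h⟩
      · exact absurd (h ▸ hr) ha'
    · rintro ⟨r, hr, hrW⟩; exact ⟨r, hr, Or.inl hrW⟩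
  by_cases h0 : ∃ r ∈ ent, r ∈ W <;> by_cases h1 : ∃ r ∈ ent', r ∈ W
  all_goals simp only [Finset.mem_union, Finset.mem_singleton, hu, h0, h1, ha'W, or_true,
    if_true, if_false]
  all_goals ring

omit [Fintype V] [Fintype E] [DecidableEq E] [LinearOrder R] [IsStrictOrderedRing R] in
/-- With sure coins on `ent` and `ent'`, the nested gate value of the general chain is
`chainMix ent ent' ρ chainC chainD'`. -/
lemma gValK_sure_chainGen_eq (A : Finset V → R) (pr : E → R) (ha' : a' ∉ ent)
    (hsure : ∀ r ∈ ent, pr (c r) = 1) (hsure' : ∀ r ∈ ent', pr (c' r) = 1)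
    (W : Finset V) (ha'W : a' ∉ W) :
    tailWtK pr ent' c' W * gValK A pr (insert a' ent) c a w W +
      (1 - tailWtK pr ent' c' W) * gValK A pr (insert a' ent) c a w (W ∪ {a'}) =
      chainMix ent ent' (pr (c a')) (fun X => A (chainPhi ent' a' X))
        (fun X => A (chainPhi ent' a' X ∪ {a, w})) W := by
  unfold gValK chainMix chainTheta chainPhi
  rw [tailWtK_sure pr c' hsure' W, tailWtK_insert_sure pr c ha' hsure,
    tailWtK_insert_sure pr c ha' hsure]
  have hu : (∃ r ∈ ent, r ∈ W ∨ r = a') ↔ ∃ r ∈ ent, r ∈ W := by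
    constructor
    · rintro ⟨r, hr, h | h⟩
      · exact ⟨r, hr, h⟩
      · exact absurd (h ▸ hr) ha'
    · rintro ⟨r, hr, hrW⟩; exact ⟨r, hr, Or.inl hrW⟩
  by_cases h0 : ∃ r ∈ ent, r ∈ W <;> by_cases h1 : ∃ r ∈ ent', r ∈ W
  all_goals simp only [Finset.mem_union, Finset.mem_singleton, hu, h0, h1, ha'W, or_true,
    if_true, if_false]
  all_goals ring

omit [Fintype V] [IsStrictOrderedRing R] in
/-- **THE REDUCTION FOR THE GENERAL CHAIN.**  Row 2′DARC at the general chain follows from the nonnegativity of the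
chain functional of the data `ν = P(level)`, `c = A ∘ chainPhi`, `d = A (chainPhi · ∪ {a})`,
`d' = A (chainPhi · ∪ {a, w})`, `ρ = pr (c a')`, with `A X = P(X avoids t)` (`hF`). -/
theorem chain_darc_of_functional (pr : E → R) (hS : SameEnds arcs)
    (h' : OrTailK arcs s U ent' c' a') (hsure' : ∀ r ∈ ent', pr (c' r) = 1)
    (h : OrTailK arcs s (insert a' U) (insert a' ent) c a) (hsure : ∀ r ∈ ent, pr (c r) = 1) (hentU : ent ⊆ U)
    {m₁ m₂ : V} (hm₁ : m₁ ∈ U) (hm₂ : m₂ ∈ U)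
    {t : V} (htC : t ∉ insert a (insert a' U)) (hts : t ≠ s) (hws : w ≠ s)
    (hwC : w ∉ insert a (insert a' U))
    (hF : 0 ≤ (∑ W ∈ U.powerset, prob pr (coreLevel arcs s U W) *
            chainMix ent ent' (pr (c a')) (chainC pr arcs s t U ent' a' a) (chainD pr arcs s t U ent' a' a) W) ^ 2 *
          (∑ W ∈ U.powerset, prob pr (coreLevel arcs s U W) *
            chainMix ent ent' (pr (c a')) (chainC pr arcs s t U ent' a' a) (chainD' pr arcs s t U ent' a' a w) W *
            ((if m₁ ∈ W then (1 : R) else 0) * (if m₂ ∈ W then (1 : R) else 0)))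
        - (∑ W ∈ U.powerset, prob pr (coreLevel arcs s U W) *
            chainMix ent ent' (pr (c a')) (chainC pr arcs s t U ent' a' a) (chainD pr arcs s t U ent' a' a) W) *
          (∑ W ∈ U.powerset, prob pr (coreLevel arcs s U W) *
            chainMix ent ent' (pr (c a')) (chainC pr arcs s t U ent' a' a) (chainD pr arcs s t U ent' a' a) W *
            (if m₁ ∈ W then (1 : R) else 0)) *
          (∑ W ∈ U.powerset, prob pr (coreLevel arcs s U W) *
            chainMix ent ent' (pr (c a')) (chainC pr arcs s t U ent' a' a) (chainD' pr arcs s t U ent' a' a w) W *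
            (if m₂ ∈ W then (1 : R) else 0))
        - (∑ W ∈ U.powerset, prob pr (coreLevel arcs s U W) *
            chainMix ent ent' (pr (c a')) (chainC pr arcs s t U ent' a' a) (chainD pr arcs s t U ent' a' a) W) *
          (∑ W ∈ U.powerset, prob pr (coreLevel arcs s U W) *
            chainMix ent ent' (pr (c a')) (chainC pr arcs s t U ent' a' a) (chainD pr arcs s t U ent' a' a) W *
            (if m₂ ∈ W then (1 : R) else 0)) *
          (∑ W ∈ U.powerset, prob pr (coreLevel arcs s U W) *
            chainMix ent ent' (pr (c a')) (chainC pr arcs s t U ent' a' a) (chainD' pr arcs s t U ent' a' a w) W *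
            (if m₁ ∈ W then (1 : R) else 0))
        + (∑ W ∈ U.powerset, prob pr (coreLevel arcs s U W) *
            chainMix ent ent' (pr (c a')) (chainC pr arcs s t U ent' a' a) (chainD pr arcs s t U ent' a' a) W *
            (if m₁ ∈ W then (1 : R) else 0)) *
          (∑ W ∈ U.powerset, prob pr (coreLevel arcs s U W) *
            chainMix ent ent' (pr (c a')) (chainC pr arcs s t U ent' a' a) (chainD pr arcs s t U ent' a' a) W *
            (if m₂ ∈ W then (1 : R) else 0)) *
          (∑ W ∈ U.powerset, prob pr (coreLevel arcs s U W) *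
            chainMix ent ent' (pr (c a')) (chainC pr arcs s t U ent' a' a) (chainD' pr arcs s t U ent' a' a w) W)) :
    DARC pr arcs s {t} m₁ m₂ a w := by
  have hC := h.closedInCoreU
  have ha'U : a' ∉ U := h'.a_notin
  have ha'E : a' ∉ ent := fun hx => ha'U (hentU hx)
  have haU' : a ∉ insert a' U := h.a_notin
  have hm₁a : m₁ ≠ a := fun e => haU' (e ▸ Finset.mem_insert_of_mem hm₁)
  have hm₂a : m₂ ≠ a := fun e => haU' (e ▸ Finset.mem_insert_of_mem hm₂)
  have hm₁a' : m₁ ≠ a' := fun e => ha'U (e ▸ hm₁)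
  have hm₂a' : m₂ ≠ a' := fun e => ha'U (e ▸ hm₂)
  have hm₁C : m₁ ∈ insert a (insert a' U) :=
    Finset.mem_insert_of_mem (Finset.mem_insert_of_mem hm₁)
  have hm₂C : m₂ ∈ insert a (insert a' U) :=
    Finset.mem_insert_of_mem (Finset.mem_insert_of_mem hm₂)
  have haC : a ∈ insert a (insert a' U) := Finset.mem_insert_self _ _
  unfold DARC
  rw [hC.phiC_gate_eq pr hS htC hts hm₁C hm₂C haC hws hwC]
  have hm1 : ∀ W : Finset V, (fun _ : Finset V => (1 : R)) (insert a W) = (fun _ => (1 : R)) W :=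
    fun _ => rfl
  have hm1' : ∀ W : Finset V, (fun _ : Finset V => (1 : R)) (insert a' W) = (fun _ => (1 : R)) W :=
    fun _ => rfl
  have hmp : ∀ W : Finset V, (fun W : Finset V => if m₁ ∈ W then (1 : R) else 0) (insert a W) =
      (fun W : Finset V => if m₁ ∈ W then (1 : R) else 0) W := fun W => by
    simp only [Finset.mem_insert, hm₁a, false_or]
  have hmp' : ∀ W : Finset V, (fun W : Finset V => if m₁ ∈ W then (1 : R) else 0) (insert a' W) =
      (fun W : Finset V => if m₁ ∈ W then (1 : R) else 0) W := fun W => by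
    simp only [Finset.mem_insert, hm₁a', false_or]
  have hmq : ∀ W : Finset V, (fun W : Finset V => if m₂ ∈ W then (1 : R) else 0) (insert a W) =
      (fun W : Finset V => if m₂ ∈ W then (1 : R) else 0) W := fun W => by
    simp only [Finset.mem_insert, hm₂a, false_or]
  have hmq' : ∀ W : Finset V, (fun W : Finset V => if m₂ ∈ W then (1 : R) else 0) (insert a' W) =
      (fun W : Finset V => if m₂ ∈ W then (1 : R) else 0) W := fun W => by
    simp only [Finset.mem_insert, hm₂a', false_or]
  have hmpq : ∀ W : Finset V,
      (fun W : Finset V => (if m₁ ∈ W then (1 : R) else 0) * (if m₂ ∈ W then (1 : R) else 0))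
        (insert a W) =
      (fun W : Finset V => (if m₁ ∈ W then (1 : R) else 0) * (if m₂ ∈ W then (1 : R) else 0)) W :=
    fun W => by simp only [Finset.mem_insert, hm₁a, hm₂a, false_or]
  have hmpq' : ∀ W : Finset V,
      (fun W : Finset V => (if m₁ ∈ W then (1 : R) else 0) * (if m₂ ∈ W then (1 : R) else 0))
        (insert a' W) =
      (fun W : Finset V => (if m₁ ∈ W then (1 : R) else 0) * (if m₂ ∈ W then (1 : R) else 0)) W :=
    fun W => by simp only [Finset.mem_insert, hm₁a', hm₂a', false_or]
  have eΛ := h.sum_R_eq pr t (fun _ => (1 : R)) hm1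
  have eFa := h.sum_R_eq pr t (fun W => if m₁ ∈ W then (1 : R) else 0) hmp
  have eFb := h.sum_R_eq pr t (fun W => if m₂ ∈ W then (1 : R) else 0) hmq
  have eM := h.sum_G_eq (w := w) pr t (fun _ => (1 : R)) hm1
  have eX := h.sum_G_eq (w := w) pr t (fun W => if m₁ ∈ W then (1 : R) else 0) hmp
  have eY := h.sum_G_eq (w := w) pr t (fun W => if m₂ ∈ W then (1 : R) else 0) hmq
  have eXY := h.sum_G_eq (w := w) pr t
    (fun W => (if m₁ ∈ W then (1 : R) else 0) * (if m₂ ∈ W then (1 : R) else 0)) hmpq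
  simp only [mul_one] at eΛ eM
  rw [eΛ, eFa, eFb, eM, eX, eY, eXY]
  set A : Finset V → R := fun X => prob pr (coreAvoidEvent arcs s t (insert a (insert a' U)) X)
    with hAdef
  have fΛ := h'.sum_gen pr (rValK A pr (insert a' ent) c a) (fun _ => (1 : R)) hm1'
  have fFa := h'.sum_gen pr (rValK A pr (insert a' ent) c a) (fun W => if m₁ ∈ W then (1 : R) else 0) hmp'
  have fFb := h'.sum_gen pr (rValK A pr (insert a' ent) c a) (fun W => if m₂ ∈ W then (1 : R) else 0) hmq'
  have fM := h'.sum_gen pr (gValK A pr (insert a' ent) c a w) (fun _ => (1 : R)) hm1'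
  have fX := h'.sum_gen pr (gValK A pr (insert a' ent) c a w) (fun W => if m₁ ∈ W then (1 : R) else 0) hmp'
  have fY := h'.sum_gen pr (gValK A pr (insert a' ent) c a w) (fun W => if m₂ ∈ W then (1 : R) else 0) hmq'
  have fXY := h'.sum_gen pr (gValK A pr (insert a' ent) c a w)
    (fun W => (if m₁ ∈ W then (1 : R) else 0) * (if m₂ ∈ W then (1 : R) else 0)) hmpq'
  simp only [mul_one] at fΛ fM
  rw [fΛ, fFa, fFb, fM, fX, fY, fXY]
  -- the chain data
  have ha'W : ∀ W ∈ U.powerset, a' ∉ W := fun W hW hx => ha'U (Finset.mem_powerset.1 hW hx)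
  have eR : ∀ m : Finset V → R,
      ∑ W ∈ U.powerset, prob pr (coreLevel arcs s U W) *
        (tailWtK pr ent' c' W * rValK A pr (insert a' ent) c a W +
          (1 - tailWtK pr ent' c' W) * rValK A pr (insert a' ent) c a (W ∪ {a'})) * m W =
      ∑ W ∈ U.powerset, prob pr (coreLevel arcs s U W) *
        chainMix ent ent' (pr (c a')) (fun X => A (chainPhi ent' a' X))
          (fun X => A (chainPhi ent' a' X ∪ {a})) W * m W :=
    fun m => Finset.sum_congr rfl fun W hW => by
      rw [rValK_sure_chainGen_eq (c := c) (a := a) A pr ha'E hsure hsure' W (ha'W W hW)]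
  have eR0 : ∑ W ∈ U.powerset, prob pr (coreLevel arcs s U W) *
        (tailWtK pr ent' c' W * rValK A pr (insert a' ent) c a W +
          (1 - tailWtK pr ent' c' W) * rValK A pr (insert a' ent) c a (W ∪ {a'})) =
      ∑ W ∈ U.powerset, prob pr (coreLevel arcs s U W) *
        chainMix ent ent' (pr (c a')) (fun X => A (chainPhi ent' a' X))
          (fun X => A (chainPhi ent' a' X ∪ {a})) W :=
    Finset.sum_congr rfl fun W hW => by
      rw [rValK_sure_chainGen_eq (c := c) (a := a) A pr ha'E hsure hsure' W (ha'W W hW)]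
  have eG : ∀ m : Finset V → R,
      ∑ W ∈ U.powerset, prob pr (coreLevel arcs s U W) *
        (tailWtK pr ent' c' W * gValK A pr (insert a' ent) c a w W +
          (1 - tailWtK pr ent' c' W) * gValK A pr (insert a' ent) c a w (W ∪ {a'})) * m W =
      ∑ W ∈ U.powerset, prob pr (coreLevel arcs s U W) *
        chainMix ent ent' (pr (c a')) (fun X => A (chainPhi ent' a' X))
          (fun X => A (chainPhi ent' a' X ∪ {a, w})) W * m W :=
    fun m => Finset.sum_congr rfl fun W hW => by
      rw [gValK_sure_chainGen_eq (c := c) (a := a) (w := w) A pr ha'E hsure hsure' W (ha'W W hW)]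
  have eG0 : ∑ W ∈ U.powerset, prob pr (coreLevel arcs s U W) *
        (tailWtK pr ent' c' W * gValK A pr (insert a' ent) c a w W +
          (1 - tailWtK pr ent' c' W) * gValK A pr (insert a' ent) c a w (W ∪ {a'})) =
      ∑ W ∈ U.powerset, prob pr (coreLevel arcs s U W) *
        chainMix ent ent' (pr (c a')) (fun X => A (chainPhi ent' a' X))
          (fun X => A (chainPhi ent' a' X ∪ {a, w})) W :=
    Finset.sum_congr rfl fun W hW => by
      rw [gValK_sure_chainGen_eq (c := c) (a := a) (w := w) A pr ha'E hsure hsure' W (ha'W W hW)]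
  rw [eR0, eG0, eR (fun W => if m₁ ∈ W then (1 : R) else 0),
    eR (fun W => if m₂ ∈ W then (1 : R) else 0), eG (fun W => if m₁ ∈ W then (1 : R) else 0),
    eG (fun W => if m₂ ∈ W then (1 : R) else 0),
    eG (fun W => (if m₁ ∈ W then (1 : R) else 0) * (if m₂ ∈ W then (1 : R) else 0))]
  exact hF

end ChainReductionGen

end Summit.Ventures.PercRepro2.Coin
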